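import Summits.QuantumFields.YangMills.Theorems.UnitScaleTiltProp7FibreLevelMassT3Letters
import HarnessLib

/-!
# Route `UnitScaleTilt`, crux K1 «MinimiserStabilityRegPr» (stmt-QuantumFields-19200), route-R [RP] curved, row (n3) N3b, file F4c —
# TWO SCALAR LETTERS FOR THE (n3) KNIT AT d = 3: `ρ₁ = (L³)⁻¹L = L⁻²` and the `ℓ¹` level exponential `E_k = exp((κ₁∕ρ₁)Σ_{i<k}a_i) ≤ 3∕2`

Cell `ym3-torus`, D-0154 (3c) extra-width seat `ym-routeR-w6` (gen 3); offered on the bus 2026-08-28 16:08Z («routeR-w6: F4c») for ★w4-19200 g5's F5 `…Prop7JointRowOfSuppliers`.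
THEOREMS ONLY (0 `def`, 0 `sorry`); `--supports stmt-QuantumFields-19200`, count-neutral.  YM₃ on T³ is a ladder rung (R3), not the Clay problem; nothing here claims the stub,
the crux, d = 4 or the mass gap.

THE POINT.  ✓ F2 `Prop7FibreLogRatioGaugedL1.sum_norm_trueLinIter_add_pureGauge_expChart_le_log` (and ✓ F2′) weigh the level-`l` source by `ρ₁^{k−1−l}`,
`ρ₁ = (L^d)⁻¹L`, with the prefactor `E_k = exp((159((d+2)L)(2d))∕ρ₁·Σ_{i<k}a_i)`; ✓ F4 `Prop7JointRowOfLevelMasses.jointRow_of_levelMasses` wants the weights as `((L²)⁻¹)^{k−1−l}`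
and a constant `E`.  At d = 3: `(L³)⁻¹L = (L²)⁻¹`, and `κ₁∕ρ₁ = 318·d(d+2)·L^d` is the SAME number as the `ℓ²` engine's `κ∕ρ` (✓ `Prop7CurvedLandauRowE.kappa_eq_mul_rho`), so at the
tower loop sizes `a_i = ((d+2)L)²∕2·2ε·L^{2i}∕ℓ²` of ✓ `loop_size_geom` the exponent is `≤ 1∕3` under `10⁶L⁵ε ≤ 1` exactly as in ✓ `…T3Letters.level_exp_le`, whence `E_k ≤ 3∕2`.

WHAT IS PROVED (ns `…Theorems.Prop7L1LevelExpT3`): `kappa1_div_rho1_eq` (any `P`), `rho1_eq_T3`, ★ `l1_level_exp_le_T3`.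
References: T. Bałaban, CMP 98 (1985) 17–51 [Balaban1985Averaging] (Prop. 3 (124)–(126) p.36); CMP 95 (1984) 17–40 [Balaban1984PropagatorsI] ((1.18)–(1.20) pp.19–20).
-/

set_option autoImplicit false

noncomputable section

open scoped BigOperators

namespace Summit.QuantumFields.YangMills.Theorems.Prop7L1LevelExpT3

open Literature.MathematicalPhysics.QuantumFieldTheory.Balaban1983to89
open Literature.MathematicalPhysics.QuantumFieldTheory.Balaban1983to89.T3ContinuumYM3Torus
open Finset T4Continuum
open Summit.QuantumFields.YangMills.Theorems.Prop7CurvedLandauKnitT3 (smallness_T3 three_le_L)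
open Summit.QuantumFields.YangMills.Theorems.Prop7CurvedLandauRowE (sum_range_pow_div_le_third exp_third_le)

/-- `κ₁∕ρ₁ = 318·d(d+2)·L^d`: `159·((d+2)L)·(2d) ∕ ((L^d)⁻¹·L) = 318·d·(d+2)·L^d` for any parameters. [folklore] -/
theorem kappa1_div_rho1_eq (P : Params) :
    (159 * (((P.d + 2) * P.L : ℕ) : ℝ) * (2 * P.d)) / (((P.L : ℝ) ^ P.d)⁻¹ * (P.L : ℝ)) = 318 * P.d * (P.d + 2) * (P.L : ℝ) ^ P.d := by
  have hL : (0 : ℝ) < (P.L : ℝ) := by exact_mod_cast P.L_pos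
  have hLd : (0 : ℝ) < (P.L : ℝ) ^ P.d := by positivity
  push_cast
  field_simp
  ring

/-- `ρ₁ = (L³)⁻¹·L = (L²)⁻¹` on the d = 3 torus family. [folklore] -/
theorem rho1_eq_T3 (F : T3Family) (K : ℕ) :
    ((((F.P K).L : ℝ)) ^ (F.P K).d)⁻¹ * ((F.P K).L : ℝ) = (((F.L : ℝ)) ^ 2)⁻¹ := by
  have hd : (F.P K).d = 3 := rfl
  have hLF : (((F.P K).L : ℝ)) = (F.L : ℝ) := rfl
  have hL3 := three_le_L F
  have hL0 : (0 : ℝ) < (F.L : ℝ) := by linarith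
  rw [hd, hLF]
  field_simp

/-- ★ **THE `ℓ¹` LEVEL EXPONENTIAL IS AT MOST `3∕2`** (d = 3, `SU(2)` run `K`, depth `K − n`): with the tower loop sizes `a_i = ((d+2)L)²∕2·(2ε)·L^{2i}∕L^{2(K−n)}` of
✓ `loop_size_geom` and `10⁶L⁵ε ≤ 1`, for every `j ≤ K − n`: `exp((159((d+2)L)(2d))∕((L^d)⁻¹L)·Σ_{i<j}a_i) ≤ 3∕2` (exponent `≤ 1∕3`: `κ₁∕ρ₁ = 318d(d+2)L^d`,
`Σ_{i<j}L^{2i}∕L^{2(K−n)} ≤ 1∕3`, `159d(d+2)³L^{d+2}(2ε) ≤ 1`). [cite: Balaban1985Averaging, Prop. 3 (124)-(126) p.36] -/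
theorem l1_level_exp_le_T3 (F : T3Family) (n K : ℕ) {ε : ℝ} (hε : 0 < ε) (hεL : 1000000 * (F.L : ℝ) ^ 5 * ε ≤ 1) (j : ℕ) (hj : j ≤ K - n) :
    Real.exp ((159 * ((((F.P K).d + 2) * (F.P K).L : ℕ) : ℝ) * (2 * (F.P K).d)) / (((((F.P K).L : ℝ)) ^ (F.P K).d)⁻¹ * ((F.P K).L : ℝ))
      * ∑ i ∈ Finset.range j, (((((F.P K).d + 2) * (F.P K).L : ℕ) : ℝ) ^ 2 / 2 * (2 * ε) * ((((F.P K).L : ℝ)) ^ (2 * i) / (((F.P K).L : ℝ)) ^ (2 * (K - n))))) ≤ 3 / 2 := by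
  have hL3 := three_le_L F
  have hLF : (((F.P K).L : ℝ)) = (F.L : ℝ) := rfl
  obtain ⟨-, -, -, -, hεκ⟩ := smallness_T3 F K hε hεL
  have hL2 : (2 : ℝ) ≤ ((F.P K).L : ℝ) := by rw [hLF]; linarith
  rw [kappa1_div_rho1_eq (F.P K)]
  refine (Real.exp_le_exp.2 ?_).trans exp_third_le
  have ha0 : ∀ i ∈ Finset.range (K - n), 0 ≤ (((((F.P K).d + 2) * (F.P K).L : ℕ) : ℝ) ^ 2 / 2 * (2 * ε) * ((((F.P K).L : ℝ)) ^ (2 * i) / (((F.P K).L : ℝ)) ^ (2 * (K - n)))) := fun i _ => by positivity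
  have hmono : ∑ i ∈ Finset.range j, (((((F.P K).d + 2) * (F.P K).L : ℕ) : ℝ) ^ 2 / 2 * (2 * ε) * ((((F.P K).L : ℝ)) ^ (2 * i) / (((F.P K).L : ℝ)) ^ (2 * (K - n)))) ≤ ∑ i ∈ Finset.range (K - n), (((((F.P K).d + 2) * (F.P K).L : ℕ) : ℝ) ^ 2 / 2 * (2 * ε) * ((((F.P K).L : ℝ)) ^ (2 * i) / (((F.P K).L : ℝ)) ^ (2 * (K - n)))) :=
    Finset.sum_le_sum_of_subset_of_nonneg (Finset.range_mono hj) (fun i hi _ => ha0 i hi)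
  have hA3 : ∑ i ∈ Finset.range (K - n), (((((F.P K).d + 2) * (F.P K).L : ℕ) : ℝ) ^ 2 / 2 * (2 * ε) * ((((F.P K).L : ℝ)) ^ (2 * i) / (((F.P K).L : ℝ)) ^ (2 * (K - n)))) ≤ ((((F.P K).d + 2) * (F.P K).L : ℕ) : ℝ) ^ 2 / 2 * (2 * ε) / 3 := by
    rw [← Finset.mul_sum]
    have := sum_range_pow_div_le_third hL2 (K - n)
    have h0 : 0 ≤ ((((F.P K).d + 2) * (F.P K).L : ℕ) : ℝ) ^ 2 / 2 * (2 * ε) := by positivity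
    nlinarith
  have hMCa : 318 * (F.P K).d * (((F.P K).d : ℝ) + 2) * ((F.P K).L : ℝ) ^ (F.P K).d * (((((F.P K).d + 2) * (F.P K).L : ℕ) : ℝ) ^ 2 / 2 * (2 * ε)) ≤ 1 := by
    have : 318 * (F.P K).d * (((F.P K).d : ℝ) + 2) * ((F.P K).L : ℝ) ^ (F.P K).d * (((((F.P K).d + 2) * (F.P K).L : ℕ) : ℝ) ^ 2 / 2 * (2 * ε))
        = 159 * (F.P K).d * (((F.P K).d : ℝ) + 2) ^ 3 * ((F.P K).L : ℝ) ^ ((F.P K).d + 2) * (2 * ε) := by push_cast; ring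
    rw [this]; exact hεκ
  have hM0 : (0 : ℝ) ≤ 318 * (F.P K).d * (((F.P K).d : ℝ) + 2) * ((F.P K).L : ℝ) ^ (F.P K).d := by positivity
  have h1 := mul_le_mul_of_nonneg_left (hmono.trans hA3) hM0
  have e : (318 * ((F.P K).d : ℝ) * (((F.P K).d : ℝ) + 2) * ((F.P K).L : ℝ) ^ (F.P K).d) * (((((F.P K).d + 2) * (F.P K).L : ℕ) : ℝ) ^ 2 / 2 * (2 * ε) / 3)
      = (318 * (F.P K).d * (((F.P K).d : ℝ) + 2) * ((F.P K).L : ℝ) ^ (F.P K).d * (((((F.P K).d + 2) * (F.P K).L : ℕ) : ℝ) ^ 2 / 2 * (2 * ε))) / 3 := by ring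
  rw [e] at h1
  linarith

end Summit.QuantumFields.YangMills.Theorems.Prop7L1LevelExpT3

end
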